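import Summits.CriticalPhenomena.PercolationContinuityZ3.Theorems.PercNearOneGluingAdditiveGluingKernelCornerForm
import Literature.Probability.Percolation.KozmaNitzanPreFKG
import HarnessLib

/-! # Crux `PercNearOneGluing.AdditiveGluing` (stmt-CriticalPhenomena-4576), line `peel` — the QUANTITATIVE exchange certificate
# (peel cell, strategy (d) "generalise the certificates", round 2, part 2)

Support file (`--supports stmt-CriticalPhenomena-4576`); no definitions, no named facts.

`μ = prodBernoulli u`; relays `A ∋ b`; designated relay `a₀`; competitor `a`; block `S ≠ ∅`; `X = ⋃_{s∈S} {a₀ ↔ s}`,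
`Y = ⋃_{s∈S} {s ↔ b}`, `D = {a₀ ↮ a}`, `δ = μ(a↔b) − μ(a₀↔b)` (the un-glued `hmin` gap).

* `exchCertQ_lemma3ii_quant` (**surplus transfer in Kozma–Nitzan's Lemma 3(ii)**, any finite weighted graph): for a DEcreasing event
  `Q = {a₁ ↮ B}` read on the cluster of `a₁`,  `μ(D ∩ Q) · (μ(a₂↔b) − μ(a₁↔b)) ≤ μ(D) · (μ(a₂↔b ∩ Q) − μ(a₁↔b ∩ Q))`, `D = {a₁ ↮ a₂}`
  (no sign hypothesis).  This is the printed proof of Lemma 3(ii) read quantitatively: the two BHK steps (BHK 2006 Thm 1.3: `{a₁↔b}`,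
  `Q` both on `C_{a₁}`, opposite monotonicity, given `D`; Thm 1.5: `{a₂↔b}` on `C_{a₂}`, `Q` on `C_{a₁}`, given `D`) lose nothing else,
  so the conditional slack `μ(a₂↔b ∩ Q) − μ(a₁↔b ∩ Q)` inherits the fraction `μ(Q | D)` of the unconditional gap.
* `blockGood_of_exchangeQuant` (**quantitative exchange certificate**): with `Q = Xᶜ = {a₀ ↮ S}`,
  `μ(D) · BG-slack = μ(D)·[μ(Y ∩ Xᶜ) + dead credit − μ(a↔b ∩ Xᶜ)] + μ(D)·slack₃(a) ≥ μ(D)·V_a + μ(D ∩ Xᶜ)·δ`, so the block `S` is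
  `a₀`-good as soon as `μ(D) > 0` and  `μ(D)·μ(a↔b ∩ Xᶜ) ≤ μ(D)·[μ(Y ∩ Xᶜ) + Σ_{W∩A=∅} μ(K_S=W)·min_A μ(·↔b in Wᶜ)] + μ(D ∩ Xᶜ)·δ`
  (`XC_a ≥ 0`).  Exact census (peel cell lab t14, 2026-08-18): with `a = m := argmin_A μ_{u−S}(·↔b)`, `XC_m ≥ 0` in 640/640 drift
  instances of the all-relay two-hub class (n = 6) and 1026/1028 general blocks; `max_a XC_a ≥ 0` in ALL 1668 drift instances sampled —
  i.e. every exact instance of the block kernel met so far is closed by ONE quantitative single-competitor exchange.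
[cite: KozmaNitzan2024, Lemma 1 p. 5, Lemma 3(ii) pp. 6–7, §3.2 Definition p. 12] [cite: VandenbergHaggstromKahn2005, Thms. 1.3, 1.5]
-/

namespace Summit.CriticalPhenomena.PercolationContinuityZ3.Theorems

open MeasureTheory Set
open Literature.Probability.LatticeModels (prodBernoulli)
open Literature.Probability.Percolation (BondConfig openConn openConnIn openGraph openCluster openEdgeCluster)
open scoped BigOperators Classical

noncomputable section

section ExchangeCertQuant

open Literature.Probability.LatticeModels Literature.Probability.Percolation
open Literature.Probability.Percolation.KNPreFKG

/-- **Surplus transfer in Kozma–Nitzan's Lemma 3(ii).**  For vertices `a₁, a₂, b`, a vertex set `B`, `D = {a₁ ↮ a₂}` and the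
decreasing event `Q = {a₁ ↮ B}` of the cluster of `a₁`:
`μ(D ∩ Q) · (μ(a₂↔b) − μ(a₁↔b)) ≤ μ(D) · (μ(a₂↔b ∩ Q) − μ(a₁↔b ∩ Q))`.
[cite: KozmaNitzan2024, Lemma 3(ii) (pp. 6–7), Lemma 1 (p. 5)] [cite: VandenbergHaggstromKahn2005, Thms. 1.3, 1.5] -/
theorem exchCertQ_lemma3ii_quant {V : Type*} [Fintype V] (w : Sym2 V → unitInterval) (a₁ a₂ b : V) (B : Set V) :
    (prodBernoulli w).real ({ω : BondConfig V | ¬ (openGraph ω).Reachable a₁ a₂} ∩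
          {ω | ∀ u ∈ B, ¬ (openGraph ω).Reachable a₁ u})
        * ((prodBernoulli w).real (openConn a₂ b) - (prodBernoulli w).real (openConn a₁ b))
      ≤ (prodBernoulli w).real {ω : BondConfig V | ¬ (openGraph ω).Reachable a₁ a₂}
        * ((prodBernoulli w).real (openConn a₂ b ∩ {ω | ∀ u ∈ B, ¬ (openGraph ω).Reachable a₁ u})
            - (prodBernoulli w).real (openConn a₁ b ∩ {ω | ∀ u ∈ B, ¬ (openGraph ω).Reachable a₁ u})) := by
  classical
  set μ := prodBernoulli w with hμ
  set X₁ : Set (BondConfig V) := openConn a₁ b with hX₁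
  set X₂ : Set (BondConfig V) := openConn a₂ b with hX₂
  set Q : Set (BondConfig V) := {ω | ∀ u ∈ B, ¬ (openGraph ω).Reachable a₁ u} with hQ
  set D : Set (BondConfig V) := {ω | ¬ (openGraph ω).Reachable a₁ a₂} with hD
  by_cases h12 : a₁ = a₂
  · -- `D = ∅`
    have hD0 : D = ∅ := by
      ext ω
      simp only [hD, mem_setOf_eq, mem_empty_iff_false, iff_false, not_not, h12]
      exact SimpleGraph.Reachable.refl _
    simp [hD0]
  -- on `Dᶜ` the two connection events agree
  have hagree : X₁ ∩ Dᶜ = X₂ ∩ Dᶜ := by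
    ext ω
    simp only [mem_inter_iff, mem_compl_iff, mem_setOf_eq, not_not, hX₁, hX₂, hD, openConn]
    constructor
    · rintro ⟨h1, h2⟩
      exact ⟨h2.symm.trans h1, h2⟩
    · rintro ⟨h1, h2⟩
      exact ⟨h2.trans h1, h2⟩
  have hsplit : ∀ E : Set (BondConfig V), μ.real E = μ.real (E ∩ D) + μ.real (E ∩ Dᶜ) := by
    intro E
    rw [← measureReal_inter_add_sdiff (s := E) (MeasurableSet.of_discrete : MeasurableSet D), Set.sdiff_eq]
  -- the unconditional gap lives on `D`
  have hgap : μ.real X₂ - μ.real X₁ = μ.real (D ∩ X₂) - μ.real (D ∩ X₁) := by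
    rw [hsplit X₁, hsplit X₂, hagree, inter_comm D X₁, inter_comm D X₂]
    ring
  -- the conditional gap lives on `D`
  have hagreeQ : X₁ ∩ Q ∩ Dᶜ = X₂ ∩ Q ∩ Dᶜ := by
    rw [inter_right_comm, hagree, inter_right_comm]
  have hgapQ : μ.real (X₂ ∩ Q) - μ.real (X₁ ∩ Q) = μ.real (D ∩ (X₂ ∩ Q)) - μ.real (D ∩ (X₁ ∩ Q)) := by
    rw [hsplit (X₁ ∩ Q), hsplit (X₂ ∩ Q), hagreeQ, inter_comm D (X₁ ∩ Q), inter_comm D (X₂ ∩ Q)]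
    ring
  -- (1) one-cluster BHK: `s = a₁`, `X = {a₂}`, increasing `{a₁ ↔ b}`, decreasing `Q` (both on `C_{a₁}`)
  have hD1 : {ω : BondConfig V | ∀ x ∈ ({a₂} : Set V), ¬ (openGraph ω).Reachable a₁ x} = D := by
    ext ω
    simp [hD]
  have h1 := bhk_one_upper_lower w a₁ ({a₂} : Set V) (by simpa using h12)
    (isUpperSet_connFamily a₁ b) (isLowerSet_disconnFamily a₁ B)
  rw [hD1, ← openConn_eq_setOf_connFamily, ← setOf_forall_not_reachable_eq] at h1
  -- (2) two-cluster BHK: `s = a₂`, `t = a₁`, increasing `{a₂ ↔ b}` on `C_{a₂}`, decreasing `Q` on `C_{a₁}`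
  have hD2 : {ω : BondConfig V | ¬ (openGraph ω).Reachable a₂ a₁} = D := by
    ext ω
    simp only [mem_setOf_eq, hD]
    exact not_congr ⟨SimpleGraph.Reachable.symm, SimpleGraph.Reachable.symm⟩
  have h3 := bhk_two_upper_lower w a₂ a₁ (Ne.symm h12) (isUpperSet_connFamily a₂ b) (isLowerSet_disconnFamily a₁ B)
  rw [hD2, ← openConn_eq_setOf_connFamily, ← setOf_forall_not_reachable_eq] at h3
  -- assemble: μ(D∩Q)(μ(D∩X₂) − μ(D∩X₁)) ≤ μ(D)(μ(D∩X₂∩Q) − μ(D∩X₁∩Q))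
  change μ.real (D ∩ Q) * (μ.real X₂ - μ.real X₁) ≤ μ.real D * (μ.real (X₂ ∩ Q) - μ.real (X₁ ∩ Q))
  rw [hgap, hgapQ]
  have e1 : D ∩ (X₁ ∩ Q) = D ∩ (openConn a₁ b ∩ Q) := rfl
  nlinarith [h1, h3, measureReal_nonneg (μ := μ) (s := D), measureReal_nonneg (μ := μ) (s := D ∩ Q)]

variable {n : ℕ}

/-- `{a₀ ↮ S}` written with the cluster of `a₀` is the complement of `X = ⋃_{s∈S} {a₀ ↔ s}`. [folklore] -/
theorem exchCertQ_notConn_eq (S : Finset (Fin n)) (a₀ : Fin n) :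
    {ω : BondConfig (Fin n) | ∀ u ∈ (S : Set (Fin n)), ¬ (openGraph ω).Reachable a₀ u}
      = (⋃ s ∈ S, (openConn a₀ s : Set (BondConfig (Fin n))))ᶜ := by
  ext ω
  simp only [Set.mem_setOf_eq, Finset.mem_coe, Set.mem_compl_iff, Set.mem_iUnion, exists_prop, not_exists, not_and]
  rfl

/-- `{a₀ ↮ a}` written with reachability is the complement of `{a₀ ↔ a}`. [folklore] -/
theorem exchCertQ_notConn_pair_eq (a₀ a : Fin n) :
    {ω : BondConfig (Fin n) | ¬ (openGraph ω).Reachable a₀ a} = (openConn a₀ a : Set (BondConfig (Fin n)))ᶜ := by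
  ext ω
  rfl

/-- **Quantitative exchange certificate for the block kernel.**  For `S ≠ ∅`, `b ∈ A`, a competitor `a` with `μ(a₀ ↮ a) > 0`
(`D = {a₀↔a}ᶜ`, `X = ⋃_{s∈S}{a₀↔s}`, `Y = ⋃_{s∈S}{s↔b}`): if
`μ(D)·μ(a↔b ∩ Xᶜ) ≤ μ(D)·[μ(Y ∩ Xᶜ) + Σ_{W∩A=∅} μ(K_S=W)·min_{a'∈A} μ(a'↔b in Wᶜ)] + μ(D ∩ Xᶜ)·(μ(a↔b) − μ(a₀↔b))`
(`XC_a ≥ 0`), then `S` is `a₀`-good: `μ(a₀↔b) + μ(a₀↮b, X, Y) ≤ μ(Y) + Σ_{W∩A=∅} μ(K_S=W)·min_{a'∈A} μ(a'↔b in Wᶜ)`.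
[cite: KozmaNitzan2024, §3.2 Definition p. 12, Lemma 3(ii) pp. 6–7] [cite: VandenbergHaggstromKahn2005, Thms. 1.3, 1.5] -/
theorem blockGood_of_exchangeQuant (u : Sym2 (Fin n) → unitInterval) (A S : Finset (Fin n)) (b a₀ a : Fin n)
    (hb : b ∈ A) (hS : S.Nonempty)
    (hD : 0 < (prodBernoulli u).real (openConn a₀ a : Set (BondConfig (Fin n)))ᶜ)
    (hXC : (prodBernoulli u).real (openConn a₀ a : Set (BondConfig (Fin n)))ᶜ
        * (prodBernoulli u).real (openConn a b ∩ (⋃ s ∈ S, openConn a₀ s)ᶜ)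
      ≤ (prodBernoulli u).real (openConn a₀ a : Set (BondConfig (Fin n)))ᶜ
          * ((prodBernoulli u).real ((⋃ s ∈ S, openConn s b) ∩ (⋃ s ∈ S, openConn a₀ s)ᶜ)
            + ∑ W ∈ (Finset.univ : Finset (Finset (Fin n))).filter (fun W => Disjoint W A),
                (prodBernoulli u).real {ω : BondConfig (Fin n) | ∀ z : Fin n, (z ∈ W ↔ ω ∈ ⋃ s ∈ S, openConn s z)}
                  * A.inf' ⟨b, hb⟩ (fun a' => (prodBernoulli u).real (openConnIn ((W : Set (Fin n))ᶜ) a' b)))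
        + (prodBernoulli u).real ((openConn a₀ a : Set (BondConfig (Fin n)))ᶜ ∩ (⋃ s ∈ S, openConn a₀ s)ᶜ)
          * ((prodBernoulli u).real (openConn a b) - (prodBernoulli u).real (openConn a₀ b))) :
    (prodBernoulli u).real (openConn a₀ b)
        + (prodBernoulli u).real ((openConn a₀ b)ᶜ ∩ (⋃ s ∈ S, openConn a₀ s) ∩ (⋃ s ∈ S, openConn s b))
      ≤ (prodBernoulli u).real (⋃ s ∈ S, openConn s b)
        + ∑ W ∈ (Finset.univ : Finset (Finset (Fin n))).filter (fun W => Disjoint W A),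
            (prodBernoulli u).real {ω : BondConfig (Fin n) | ∀ z : Fin n, (z ∈ W ↔ ω ∈ ⋃ s ∈ S, openConn s z)}
              * A.inf' ⟨b, hb⟩ (fun a' => (prodBernoulli u).real (openConnIn ((W : Set (Fin n))ᶜ) a' b)) := by
  -- a selection realising the pocketwise minimum
  have hex : ∀ W : Finset (Fin n), ∃ a' ∈ A,
      A.inf' ⟨b, hb⟩ (fun a' => (prodBernoulli u).real (openConnIn ((W : Set (Fin n))ᶜ) a' b))
        = (prodBernoulli u).real (openConnIn ((W : Set (Fin n))ᶜ) a' b) :=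
    fun W => Finset.exists_mem_eq_inf' ⟨b, hb⟩ _
  choose sel hselA hselEq using hex
  have hsum : (∑ W ∈ (Finset.univ : Finset (Finset (Fin n))).filter (fun W => Disjoint W A),
        (prodBernoulli u).real {ω : BondConfig (Fin n) | ∀ z : Fin n, (z ∈ W ↔ ω ∈ ⋃ s ∈ S, openConn s z)}
          * A.inf' ⟨b, hb⟩ (fun a' => (prodBernoulli u).real (openConnIn ((W : Set (Fin n))ᶜ) a' b)))
      = ∑ W ∈ (Finset.univ : Finset (Finset (Fin n))).filter (fun W => Disjoint W A),
        (prodBernoulli u).real {ω : BondConfig (Fin n) | ∀ z : Fin n, (z ∈ W ↔ ω ∈ ⋃ s ∈ S, openConn s z)}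
          * (prodBernoulli u).real (openConnIn ((W : Set (Fin n))ᶜ) (sel W) b) :=
    Finset.sum_congr rfl fun W _ => by rw [hselEq W]
  have h3 := kernelCorner_threeTerm u A S b a₀ sel hS hselA
  have hDE := kernelCorner_pocketSum_eq u A S b sel hS hselA
  -- quantitative Lemma 3(ii) with `a₁ = a₀`, `a₂ = a`, `B = S`
  have hq := exchCertQ_lemma3ii_quant u a₀ a b (S : Set (Fin n))
  rw [exchCertQ_notConn_eq S a₀, exchCertQ_notConn_pair_eq a₀ a] at hq
  rw [hsum] at hXC ⊢
  -- `μ(D) · K ≥ 0` and `μ(D) > 0`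
  set μD := (prodBernoulli u).real (openConn a₀ a : Set (BondConfig (Fin n)))ᶜ with hμD
  have hK : 0 ≤ μD * ((prodBernoulli u).real (⋃ s ∈ S, openConn s b)
        + (∑ W ∈ (Finset.univ : Finset (Finset (Fin n))).filter (fun W => Disjoint W A),
            (prodBernoulli u).real {ω : BondConfig (Fin n) | ∀ z : Fin n, (z ∈ W ↔ ω ∈ ⋃ s ∈ S, openConn s z)}
              * (prodBernoulli u).real (openConnIn ((W : Set (Fin n))ᶜ) (sel W) b))
        - ((prodBernoulli u).real (openConn a₀ b)
            + (prodBernoulli u).real ((openConn a₀ b)ᶜ ∩ (⋃ s ∈ S, openConn a₀ s) ∩ (⋃ s ∈ S, openConn s b)))) := by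
    rw [h3]
    nlinarith [hq, hXC, hDE, hD.le]
  have hK' : μD * 0 ≤ μD * ((prodBernoulli u).real (⋃ s ∈ S, openConn s b)
        + (∑ W ∈ (Finset.univ : Finset (Finset (Fin n))).filter (fun W => Disjoint W A),
            (prodBernoulli u).real {ω : BondConfig (Fin n) | ∀ z : Fin n, (z ∈ W ↔ ω ∈ ⋃ s ∈ S, openConn s z)}
              * (prodBernoulli u).real (openConnIn ((W : Set (Fin n))ᶜ) (sel W) b))
        - ((prodBernoulli u).real (openConn a₀ b)
            + (prodBernoulli u).real ((openConn a₀ b)ᶜ ∩ (⋃ s ∈ S, openConn a₀ s) ∩ (⋃ s ∈ S, openConn s b)))) := by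
    rw [mul_zero]; exact hK
  have hE := le_of_mul_le_mul_left hK' hD
  linarith

/-- Registered stub `stub_exchangeCertQuant_pd` (peel cell (d), round 2): the quantitative exchange certificate, ∀-closed.
[cite: KozmaNitzan2024, §3.2 Definition p. 12, Lemma 3(ii) pp. 6–7] -/
theorem stub_exchangeCertQuant_pd : ∀ (n : ℕ) (u : Sym2 (Fin n) → unitInterval) (A S : Finset (Fin n)) (b a₀ a : Fin n) (hb : b ∈ A), S.Nonempty → 0 < (prodBernoulli u).real (openConn a₀ a : Set (BondConfig (Fin n)))ᶜ → (prodBernoulli u).real (openConn a₀ a : Set (BondConfig (Fin n)))ᶜ * (prodBernoulli u).real (openConn a b ∩ (⋃ s ∈ S, openConn a₀ s)ᶜ) ≤ (prodBernoulli u).real (openConn a₀ a : Set (BondConfig (Fin n)))ᶜ * ((prodBernoulli u).real ((⋃ s ∈ S, openConn s b) ∩ (⋃ s ∈ S, openConn a₀ s)ᶜ) + ∑ W ∈ (Finset.univ : Finset (Finset (Fin n))).filter (fun W => Disjoint W A), (prodBernoulli u).real {ω : BondConfig (Fin n) | ∀ z : Fin n, (z ∈ W ↔ ω ∈ ⋃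 s ∈ S, openConn s z)} * A.inf' ⟨b, hb⟩ (fun a' => (prodBernoulli u).real (openConnIn ((W : Set (Fin n))ᶜ) a' b))) + (prodBernoulli u).real ((openConn a₀ a : Set (BondConfig (Fin n)))ᶜ ∩ (⋃ s ∈ S, openConn a₀ s)ᶜ) * ((prodBernoulli u).real (openConn a b) - (prodBernoulli u).real (openConn a₀ b)) → (prodBernoulli u).real (openConn a₀ b) + (prodBernoulli u).real ((openConn a₀ b)ᶜ ∩ (⋃ s ∈ S, openConn a₀ s) ∩ (⋃ s ∈ S, openConn s b)) ≤ (prodBernoulli u).real (⋃ s ∈ S, openConn s b) + (∑ W ∈ (Finset.univ : Finset (Finset (Fin n))).filter (fun W => Disjoint W A), (prodBernoulli u).real {ω : BondConfig (Fin n) | ∀ z : Fin n, (z ∈ W ↔ ω ∈ ⋃ s ∈ S, openConn s z)} * A.inf' ⟨b, hb⟩ (fun a' => (prodBernoulli u).real (openConnIn ((W : Set (Fin n))ᶜ) a' b))) :=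
  fun _ u A S b a₀ a hb hS hD hXC => blockGood_of_exchangeQuant u A S b a₀ a hb hS hD hXC

end ExchangeCertQuant

end

end Summit.CriticalPhenomena.PercolationContinuityZ3.Theorems
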